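import Summits.NavierStokesRegularity.NavierStokesRegularity.Theorems.ExtremiserTransienceDissipationLedgerCount
import Summits.NavierStokesRegularity.NavierStokesRegularity.Theorems.ExtremiserTransienceDissipationLedgerHeartDefs
import Summits.NavierStokesRegularity.NavierStokesRegularity.Theorems.ExtremiserTransienceNearExtremalTransiencePerFlowStubDissipationBudget
import Summits.NavierStokesRegularity.NavierStokesRegularity.Theorems.ExtremiserTransienceNearExtremalTransiencePerFlowStubViolatorDissipation
import Summits.NavierStokesRegularity.NavierStokesRegularity.Theorems.ExtremiserTransienceNearExtremalTransiencePerFlowStubUbiquityToLimit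
import Summits.NavierStokesRegularity.NavierStokesRegularity.Theorems.ExtremiserTransienceBackwardConePropagation
import Summits.NavierStokesRegularity.NavierStokesRegularity.Theorems.ExtremiserTransienceNearExtremalTransiencePerFlowOfFilamentSelectionAllTime
import HarnessLib

/-!
# LINE g10-α «dissipation ledger» (crux 26567): the UBIQUITOUS-SLICE LIOUVILLE THEOREM — unconditional — and the crux from C1 ALONE

Helper file for the crux `NearExtremalTransiencePerFlow` (stmt-NavierStokesRegularity-26567), LINE g10-α `dissipation_ledger` (planner
ns-idea-5 g10).  With L1 (`stub_dissipationBudget`, ns-net-p2 g10, p706162), L2 (`stub_violatorDissipation`, ns-net-p1 g11, p704994), L3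
(`ledgerCount_holds`, sibling file) and C2 (`stub_ubiquityToLimit`, ns-net-p1 g11) all theorems of the tree:

* `ubiquitousSliceLiouville_of_ledger`, `ubiquitousSliceLiouville_of` (verbatim ports) and
  **`ubiquitousSliceLiouville : UbiquitousSliceLiouville` — UNCONDITIONAL**: no slice of a Type-I ancient mild field with all-time linear
  local-energy growth is radially ubiquitous (at any thickness `g`, any level `η > 0`);
* `nearExtremalTransiencePerFlow_of_nearExtremiserUbiquity : NearExtremiserUbiquity → NearExtremalTransiencePerFlow` — the line's skeleton
  theorem with every hypothesis but the heart C1 discharged (proof verbatim otherwise; `E3` spelled out).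

HONEST FRAMING: the heart C1 and the crux stay OPEN; nothing about Navier–Stokes regularity or blow-up is proved; no summit is proved by a
line. [folklore]
-/

noncomputable section

open scoped Topology InnerProductSpace RealInnerProductSpace ENNReal ContDiff
open MeasureTheory Filter Set Metric Function
open Literature.Analysis Literature.Analysis.FluidPDE
open Summit.NavierStokesRegularity.NavierStokesRegularity.Theses.ExtremiserTransience
open Summit.NavierStokesRegularity.NavierStokesRegularity.Theorems
open Summit.NavierStokesRegularity.NavierStokesRegularity.Theorems.NearExtremalTransiencePerFlow
open Summit.NavierStokesRegularity.NavierStokesRegularity.Theorems.NearExtremalTransiencePerFlow.ZoneTransversality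
open Summit.NavierStokesRegularity.NavierStokesRegularity.Theorems.NearExtremalTransiencePerFlow.MemberSelection
open Summit.NavierStokesRegularity.NavierStokesRegularity.Theorems.DepletionLadder.KStar.HalfSpace

namespace Summit.NavierStokesRegularity.NavierStokesRegularity.Theorems

set_option linter.dupNamespace false

namespace NearExtremalTransiencePerFlow.DissipationLedger

/-! ### The ledger gives the ubiquitous-slice Liouville theorem -/

/-- **Ubiquitous-slice Liouville from the ledger.**  The level is `ε = min(ε₁, η√(-s)/2)` (`ε₁` the universal constant of
`exists_backwardCone_violator`), so that every half-height point of the ubiquity hypothesis is a level point and the propagation applies. -/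
theorem ubiquitousSliceLiouville_of_ledger (h3 : LedgerCount) (h1 : DissipationBudget) (h2 : ViolatorDissipation) :
    UbiquitousSliceLiouville := by
  intro K A g η W s hW hs hη hgr hub
  have hg : 0 ≤ g := by
    obtain ⟨z, hz, -⟩ := hub 0 le_rfl
    exact (abs_nonneg _).trans hz
  obtain ⟨ε₁, hε₁, hper⟩ := ScrewSymmetricLiouville.exists_backwardCone_violator
  have hsq : 0 < Real.sqrt (-s) := Real.sqrt_pos.2 (neg_pos.2 hs)
  obtain ⟨ε, hε, hεε₁, hεη⟩ : ∃ ε : ℝ, 0 < ε ∧ ε ≤ ε₁ ∧ ε < η * Real.sqrt (-s) := by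
    refine ⟨min ε₁ (η * Real.sqrt (-s) / 2), lt_min hε₁ (by positivity), min_le_left _ _, ?_⟩
    have h1 : η * Real.sqrt (-s) / 2 < η * Real.sqrt (-s) := half_lt_self (by positivity)
    exact lt_of_le_of_lt (min_le_right _ _) h1
  obtain ⟨ρ, hρ, hρW⟩ := hper ε hε hεε₁ K
  obtain ⟨c, D, a, hc, hD, ha, ha1, hsp⟩ := h2 K A ε hε
  obtain ⟨E, hE⟩ := h1 K A W hW hgr
  refine h3 (dissMeasure W) (fun τ x => ε < Real.sqrt (-τ) * ‖W τ x‖) s g ρ c D a E hs hg hρ hc hD ha ha1 ?_ ?_ ?_ ?_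
  · intro r hr
    obtain ⟨z, hz, hzη⟩ := hub r hr
    refine ⟨z, hz, ?_⟩
    show ε < Real.sqrt (-s) * ‖W s z‖
    calc ε < η * Real.sqrt (-s) := hεη
      _ = Real.sqrt (-s) * η := mul_comm _ _
      _ ≤ Real.sqrt (-s) * ‖W s z‖ := by gcongr
  · intro τ x hτ hP
    exact hρW W hW τ hτ x hP
  · intro τ x hτ hP
    exact hsp W hW hgr τ x hτ hP
  · intro R τ₁ τ₂ hR h12 h2' hτR
    exact hE 0 R τ₁ τ₂ hR h12 h2' hτR

set_option maxHeartbeats 1600000 in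

/-- The intermediate Liouville theorem from the two ANALYTIC stubs only (L3 proved above). -/
theorem ubiquitousSliceLiouville_of (hL1 : DissipationBudget) (hL2 : ViolatorDissipation) : UbiquitousSliceLiouville :=
  ubiquitousSliceLiouville_of_ledger ledgerCount_holds hL1 hL2



/-- **THE UBIQUITOUS-SLICE LIOUVILLE THEOREM, UNCONDITIONAL**: `ubiquitousSliceLiouville_of` with the landed analytic stubs L1
(`stub_dissipationBudget`, p706162) and L2 (`stub_violatorDissipation`, p704994). [folklore] -/
theorem ubiquitousSliceLiouville : UbiquitousSliceLiouville :=
  ubiquitousSliceLiouville_of stub_dissipationBudget stub_violatorDissipation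

/-! ### The crux from C1 alone -/

/-- **The crux `NearExtremalTransiencePerFlow` from the heart C1 `NearExtremiserUbiquity` ALONE** (the skeleton theorem of LINE g10-α with
L1, L2 discharged by the landed `stub_dissipationBudget` (p706162) / `stub_violatorDissipation` (p704994) and C2 by the landed
`stub_ubiquityToLimit` (ns-net-p1 g11); proof otherwise verbatim, planner ns-idea-5 g10).  Violator frame by contradiction → F1 budget `A` (`flowFilamentBudget`) →
T0 data (`efficientTimesNoDust_holds`) → T2′ zoom family + flow compactness (`zoomPackageFlow`) → growth of the members (`ballEnergy_zoom_le`) →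
C1 eventually at every radius `d` → diagonal subsequence and centres (`Filter.extraction_forall_of_eventually`) → limit field `W`, slice `W s` →
C2: `W s` radially ubiquitous → G′ (`growthTransferFlow`): all-time growth → `UbiquitousSliceLiouville`: contradiction. -/
theorem nearExtremalTransiencePerFlow_of_nearExtremiserUbiquity (hC1 : NearExtremiserUbiquity) : NearExtremalTransiencePerFlow := by
  -- the ledger's Liouville theorem is unconditional (L1, L2, L3, C2 and the backward-cone propagation are theorems)
  have hL : UbiquitousSliceLiouville := ubiquitousSliceLiouville
  have hT0 : EfficientTimesNoDust := efficientTimesNoDust_holds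
  intro C ν T hC hν hT u p hsol hLH hdec hrate hsing
  by_contra hno
  have hV : IsViolator C ν T u p := ⟨hC, hν, hT, hsol, hLH, hdec, hrate, hsing, hno⟩
  -- F1: the filament budget of the flow (landed)
  obtain ⟨A, hA⟩ := FilamentGap.flowFilamentBudget C ν T hC hν hT u p hsol hLH hdec hrate
  -- T0: near-efficient late times with a Taylor bound (landed)
  obtain ⟨Θ, t, Mb, ε, hdata⟩ := hT0 C ν T u p hV
  -- T2′: zoom family and flow-level compactness (landed)
  obtain ⟨σ, Λ, Θ', ε', hσ, hfam, hcompF⟩ := FilamentSelection.zoomPackageFlow C ν T u p hV Θ t Mb ε hdata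
  -- the zoom family
  set V : ℕ → (EuclideanSpace ℝ (Fin 3)) → (EuclideanSpace ℝ (Fin 3)) := fun n z => (Mb (σ n))⁻¹ • u (t (σ n)) ((ν / Mb (σ n)) • z) with hVdef
  obtain ⟨hcd, hdiv, hle1, hder, hfin, hε0, hpos, heff, htay⟩ := hfam
  -- growth of the members, eventually (F1 + scale invariance of the budget)
  have htT : Tendsto (fun n => t (σ n)) atTop (𝓝[<] T) := by
    have h1 : Tendsto (fun n => t (σ n)) atTop (𝓝 T) := hdata.2.1.comp hσ.tendsto_atTop
    exact tendsto_nhdsWithin_iff.2 ⟨h1, Eventually.of_forall fun n => (hdata.1 (σ n)).2⟩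
  have hgrV : ∀ᶠ n in atTop, ∀ (x : (EuclideanSpace ℝ (Fin 3))) (R : ℝ), 0 < R → ∫ z in Metric.ball x R, ‖V n z‖ ^ 2 ≤ A * R := by
    filter_upwards [htT.eventually hA] with n hn x R hR
    have h := FilamentSelection.ballEnergy_zoom_le hν (hdata.2.2.2.1 (σ n)) hn 0 x hR
    simpa only [zero_add] using h
  -- C1: thickness `g`; for each radius `d`, eventually the member is ubiquitous up to `d` about some centre
  obtain ⟨g, hg, hC1g⟩ := hC1 Λ Θ' A
  have hev : ∀ d : ℕ, ∀ᶠ n in atTop, ∃ y : (EuclideanSpace ℝ (Fin 3)), ∀ r : ℝ, 0 ≤ r → r ≤ (d : ℝ) →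
      ∃ z : (EuclideanSpace ℝ (Fin 3)), |‖z - y‖ - r| ≤ g ∧ (1 / 2 : ℝ) ≤ ‖V n z‖ := by
    intro d
    obtain ⟨e, he, hCe⟩ := hC1g d
    have hεe : ∀ᶠ n in atTop, ε' n < e := (tendsto_order.1 hε0).2 e he
    filter_upwards [hgrV, hεe] with n hgr hεn
    have hnn : 0 ≤ Real.sqrt (∫ x, ‖curl (V n) x‖ ^ 2) * Real.sqrt (∫ x, frobeniusNormSq (fderiv ℝ (curl (V n)) x)) :=
      mul_nonneg (Real.sqrt_nonneg _) (Real.sqrt_nonneg _)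
    have heffe : (kStar - e) * Real.sqrt (∫ x, ‖curl (V n) x‖ ^ 2) *
        Real.sqrt (∫ x, frobeniusNormSq (fderiv ℝ (curl (V n)) x)) ≤
        |∫ x, ⟪curl (V n) x, fderiv ℝ (V n) x (curl (V n) x)⟫_ℝ| := by
      refine le_trans ?_ (heff n)
      rw [mul_assoc, mul_assoc]
      exact mul_le_mul_of_nonneg_right (by linarith) hnn
    exact hCe (V n) (hcd n) (hdiv n) (hle1 n) (fun k x => hder k n x) (hfin n).1 (hfin n).2 (hpos n) heffe (htay n) hgr
  -- diagonal: a subsequence `φ` with the `d`-th member ubiquitous up to radius `d` about `c d`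
  obtain ⟨φ, hφ, hφP⟩ := extraction_forall_of_eventually hev
  choose c hc using hφP
  -- centres on the original indices
  let y : ℕ → (EuclideanSpace ℝ (Fin 3)) := fun m => c (Function.invFun φ m)
  have hy : ∀ d, y (φ d) = c d := fun d => by
    show c (Function.invFun φ (φ d)) = c d
    rw [Function.leftInverse_invFun hφ.injective d]
  -- T2′ compactness at these centres
  obtain ⟨ψ, K, s, W, hψ, hW, hs, hpin, hconvF⟩ := hcompF y φ hφ
  -- the slice family is the instance `τ = s` of the flow-level convergence
  have hconv' : ∀ z : (EuclideanSpace ℝ (Fin 3)), Tendsto (fun n => V (φ (ψ n)) (c (ψ n) + z)) atTop (𝓝 (W s z)) := by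
    intro z
    have h1 := hconvF s hs z
    simp only [sub_self, mul_zero, add_zero] at h1
    refine h1.congr' (Eventually.of_forall fun n => ?_)
    show (Mb (σ (φ (ψ n))))⁻¹ • u (t (σ (φ (ψ n)))) ((ν / Mb (σ (φ (ψ n)))) • (y (φ (ψ n)) + z)) =
      V (φ (ψ n)) (c (ψ n) + z)
    rw [hy]
  -- C2 (proved): the limit slice is radially ubiquitous
  have hub : RadiallyUbiquitous (g + 1) ((1 / 2 : ℝ) / 2) (W s) := by
    refine stub_ubiquityToLimit (fun n => V (φ (ψ n))) (Λ 1) g (1 / 2) (fun n => c (ψ n)) (fun n => ((ψ n : ℕ) : ℝ)) (W s)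
      (fun n => hcd _) (fun n x => hder 1 _ x) ?_ (fun n => hc (ψ n)) hconv'
    exact tendsto_natCast_atTop_atTop.comp hψ.tendsto_atTop
  -- G′ at every rescaled time (landed)
  have htT' : Tendsto (fun n => t (σ (φ (ψ n)))) atTop (𝓝 T) :=
    hdata.2.1.comp ((hσ.comp (hφ.comp hψ)).tendsto_atTop)
  have hgrowthAll : HasLinGrowthAllTime A W := by
    intro τ hτ
    exact FilamentSelection.growthTransferFlow ν A T u (fun n => t (σ (φ (ψ n)))) (fun n => Mb (σ (φ (ψ n))))
      (fun n => y (φ (ψ n))) s τ (W τ) hν hT (fun n => hdata.2.2.2.1 _) (fun n => (hdata.1 _).2) htT'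
      (fun t' ht' => (hsol.contDiff_velocity ht').continuous) hA hs hpin hτ (hconvF τ hτ)
  -- the ledger's Liouville theorem
  exact hL K A (g + 1) ((1 / 2 : ℝ) / 2) W s hW hs (by norm_num) hgrowthAll hub

end NearExtremalTransiencePerFlow.DissipationLedger

end Summit.NavierStokesRegularity.NavierStokesRegularity.Theorems

end
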